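import Summits.FinalStateConjecture.Statement
import Literature.Geometry.Lorentzian.KerrConvergence
import Literature.Geometry.Lorentzian.KerrConvergenceProofs
import Literature.Geometry.Lorentzian.ConvergenceTransport
import Literature.Geometry.Lorentzian.CausalityClosure
import Literature.Geometry.Lorentzian.CausalityPushUp
import Literature.Geometry.Lorentzian.StabilityCauchy
import Literature.Geometry.Lorentzian.FinalState
import HarnessLib

set_option linter.dupNamespace false

/-!
# Stub `stub_softShieldedDecomposition` of line `Sketch` of crux `CaptureSufficesC2`
# (stmt-FinalStateConjecture-14986, route `PhaseMixingCapture`): the BOOKKEEPING half, and what the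
# capture block actually hands over (typed gap B2)

The registered Stub 4 asks: given hypersurface-MGHD realisation (Stub 2) and one `CaptureAtC2`
package, every MGHD `𝓜` (with complete `𝓘⁺`) of every admissible ε-softly Kerr-shielded datum
carries `O` and a `C²` final state decomposition `dec` with sub-extremal holes,
`O = exteriorOf 𝓜 dec.charted` (`= J⁺(ι X) ∩ I⁻(charted)`) and `HasExhaustiveCharts dec`.

VERDICT of this seat (details in the lead's progress log): the stub is NOT provable by assembly from
its displayed hypotheses. Reading the definitions: `CaptureAtC2` concludes
`∃ M' a' 𝒟oc, … ∧ ConvergesToKerr 𝒟oc M' a' 2 ∧ …`, and `∃ 𝒟oc, ConvergesToKerr 𝒟oc M a k` is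
LITERALLY EQUIVALENT to "some smooth map `Ψ : Kerr.exterior M a → 𝓜`, an open embedding of
`{t* > τ₀}`, has full-slab `Cᵏ` deviation `→ 0`" (`exists_convergesToKerr_iff`, companion file: with
`𝒟oc := Ψ({t* > τ₀})` the covering clause of `IsLateEmbedding` is `∅ ⊆ _`). Nothing about WHICH
region is charted, nor about the chart's time orientation, survives; whereas `HasExhaustiveCharts`
with `O = J⁺(ι X) ∩ I⁻(charted)` forces the hole chart (a) to be bent above `ι X`, (b) to be
future-oriented in chart time, and (c) to reach EXACTLY the true event horizon at every late time
(an `o(1)`-shifted chart on exact Kerr, inwards or outwards, violates clause (ii) of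
`HasExhaustiveCharts`; ideator 2's B2). Closing (c) needs `C²` control of `g` on a strip where the
hypothesis asserts nothing — a red-shift a-priori estimate for the vacuum equations
(Dafermos–Rodnianski arXiv:0811.0354, Thms 7.1–7.2; Dafermos–Luk arXiv:1710.01722) — i.e. a genuine
theorem about `𝓜`, not bookkeeping.

What IS bookkeeping, and is proved here sorry-free:

* §1 `exists_finalStateDecomposition_of_strongChart` — a STRONG chart (smooth; open embedding of
  `{t* > τ₀}`; bent: `Ψ({t* > τ₀}) ⊆ J⁺(ι X)`; full-slab `Cᵏ` deviation `→ 0`; EXHAUSTIVE: for every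
  `τ₁ ≥ τ₀`, `O ∖ Ψ({t* > τ₁}) ⊆ J⁻(Ψ{t* = τ₁})` with `O := J⁺(ι X) ∩ I⁻(Ψ{t* > τ₀})`) of a
  sub-extremal Kerr yields an explicit `N = 1` decomposition `dec` of `O` (motion `(1, 0)`, excision
  `√t`-tubes, flat chart `Ψ|_{r > ρ(x⁰)}` as in `nonempty_finalStateDecomposition_of_convergesToKerr_holds`)
  with `dec.charted = Ψ({t* > τ₀})`, `O = exteriorOf 𝒟 dec.charted` and `HasExhaustiveCharts dec`
  (certified radii `R := ρ`)
  → registered sub-stub `stub_softShieldedDecomposition_bookkeeping` (verbatim conclusion of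
  the registered stub from a strong chart in `𝓜`);
  `convergesToKerr_exteriorOf_of_strongChart`: a strong chart IS a late-time embedding for the
  pinned region `O` (the owner's statement-level repair target for item 14985).
* companion file `…StubSoftShieldedDecompositionWeak.lean`: `exists_convergesTo(Kerr)_iff` (the
  `∃ 𝒟oc` form is coverage-void) and `ConvergesTo.image_comp` / `convergesToKerr_of_realised` (the
  capture chart of the realised leaf development `𝒟'` transports along Stub 2's `χ : 𝒟' → 𝓜` to a
  WEAK chart of `𝓜`, same deviation): `CaptureAtC2` + Stub 2 hand Stub 4 exactly a weak chart in
  `𝓜`, so the residual gap is precisely "weak chart in `𝓜` ⟹ strong chart in `𝓜`".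
* §0 two one-liners: an open set lies in its own chronological past; transport of a chart along
  an equality of reference backgrounds.

No definitions, no named facts, no `sorry`; axioms standard.

References: M. Dafermos, J. Luk, arXiv:1710.01722, Conjecture 1; M. Dafermos, G. Holzegel,
I. Rodnianski, M. Taylor, arXiv:2104.08222, §1; S. Klainerman, J. Szeftel, arXiv:2104.11857, §3;
M. Dafermos, I. Rodnianski, arXiv:0811.0354, Thms 7.1–7.2; B. O'Neill, *Semi-Riemannian geometry*
(1983), Ch. 14, pp. 402–403.
-/

noncomputable section

namespace Summit.FinalStateConjecture.FinalStateConjecture.Theorems.CaptureSufficesC2.Sketch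

open Set Filter Function Topology
open scoped Manifold ContDiff Topology
open Literature.Geometry.Lorentzian

/-! ## §0 Two causal one-liners -/

/-- **An open set lies in its own chronological past**: every point `p` of an open `U ⊆ 𝓢` is
the starting point of a short future timelike curve staying inside `U`, so `p ≪ q` for some
`q ∈ U`. O'Neill 1983, Ch. 14, p. 402 (with Ch. 5, Lemma 5.32 for the timelike curve through a
point). [cite: ONeill1983, Ch. 14, p. 402] -/
theorem subset_chronologicalPast_self_of_isOpen {𝓢 : Spacetime.{0} 4} {U : Set 𝓢.carrier}
    (hU : IsOpen U) : U ⊆ 𝓢.metric.chronologicalPast 𝓢.timeOrientation U := by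
  intro p hp
  obtain ⟨γ, ε, hε, h0, hγ⟩ :=
    𝓢.metric.exists_isFutureTimelikeCurveOn_Ioo_of_isInteriorPoint 𝓢.timeOrientation
      (BoundarylessManifold.isInteriorPoint (I := 𝓡 4) (x := p))
  have hc : ContinuousAt γ 0 := (hγ 0 (by simp [hε])).1.continuousAt
  have hev : ∀ᶠ s in 𝓝 (0 : ℝ), γ s ∈ U :=
    hc.preimage_mem_nhds (by rw [h0]; exact hU.mem_nhds hp)
  obtain ⟨δ, hδ, hball⟩ := Metric.eventually_nhds_iff_ball.mp hev
  set s : ℝ := min δ ε / 2 with hs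
  have hs0 : 0 < s := by positivity
  have hsδ : s < δ := by
    have := min_le_left δ ε
    rw [hs]; linarith
  have hsε : s < ε := by
    have := min_le_right δ ε
    rw [hs]; linarith
  have hsU : γ s ∈ U := hball s (by
    rw [Metric.mem_ball, Real.dist_eq, sub_zero, abs_of_pos hs0]; exact hsδ)
  have hfut : γ s ∈ 𝓢.metric.chronologicalFuture 𝓢.timeOrientation {p} :=
    ⟨p, rfl, γ, 0, s, hs0, hγ.mono (Icc_subset_Ioo (by linarith) hsε), h0, rfl⟩
  have hpast := LorentzianMetric.mem_chronologicalPast_of_mem_chronologicalFuture hfut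
  exact LorentzianMetric.chronologicalFuture_mono (singleton_subset_iff.2 hsU) hpast


/-- Transport of a chart along an equality of reference backgrounds (bookkeeping for
`boostedKerrBackground 1 0 M a = Kerr.background M a`): the transported chart has the same
late-chart property, the same truncated deviations and the same images of all sets cut out by the
time and radius functions. [folklore] -/
theorem exists_chart_of_background_eq {𝓢 : Spacetime.{0} 4} {B B₀ : ModelBackground}
    (hB : B = B₀) (Ψ : B₀.domain → 𝓢.carrier) :
    ∃ Ψ' : B.domain → 𝓢.carrier,
      (∀ (O : Set 𝓢.carrier) (τ₀ : ℝ), 𝓢.IsLateChart B₀ O τ₀ Ψ → 𝓢.IsLateChart B O τ₀ Ψ') ∧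
      (∀ (k : ℕ) (R τ : ℝ), 𝓢.truncDeviationCk B Ψ' k R τ = 𝓢.truncDeviationCk B₀ Ψ k R τ) ∧
      ∀ p : ℝ → ℝ → Prop, Ψ' '' {x | p (B.time x.1) (B.radius x.1)} =
        Ψ '' {x | p (B₀.time x.1) (B₀.radius x.1)} := by
  subst hB
  exact ⟨Ψ, fun _ _ h ↦ h, fun _ _ _ ↦ rfl, fun _ ↦ rfl⟩

/-! ## §1 BOOKKEEPING: a strong (bent, exhaustive) Kerr chart gives the summit's decomposition -/

section Strong

variable {X : Type} [TopologicalSpace X] [ChartedSpace E3 X] [IsManifold (𝓡 3) ∞ X]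
  [ConnectedSpace X] {D : InitialDataSet (𝓡 3) X}

/-- The late image of a bent open chart lies in the exterior region it determines,
`Ψ({t* > τ₀}) ⊆ O = J⁺(ι X) ∩ I⁻(Ψ({t* > τ₀}))` (bending clause and openness of the image).
[folklore] -/
theorem image_lateRegion_subset_exteriorOf (𝒟 : CauchyDevelopment D) {M a τ₀ : ℝ}
    {Ψ : (Kerr.background M a).domain → 𝒟.carrier}
    (hΨe : IsOpenEmbedding ((Kerr.lateRegion M a τ₀).restrict Ψ))
    (hJ : Ψ '' Kerr.lateRegion M a τ₀ ⊆ 𝒟.metric.causalFuture 𝒟.timeOrientation (range 𝒟.embed)) :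
    Ψ '' Kerr.lateRegion M a τ₀ ⊆
      Summit.FinalStateConjecture.exteriorOf 𝒟 (Ψ '' Kerr.lateRegion M a τ₀) := by
  refine subset_inter hJ ?_
  have hopen : IsOpen (Ψ '' Kerr.lateRegion M a τ₀) := by
    rw [← range_restrict]; exact hΨe.isOpen_range
  exact subset_chronologicalPast_self_of_isOpen (𝓢 := 𝒟.toSpacetime) hopen

/-- **A strong chart is a late-time EMBEDDING for the PINNED region `O = J⁺(ι X) ∩ I⁻(Ψ{t* > τ₀})`**
(exhaustion at `τ₁ = τ₀` is the covering clause), hence witnesses the capture conclusion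
`ConvergesToKerr O M a k` with the region pinned to the self-determined exterior — the strong
package REFINES what `BulkKerrCaptureC2` concludes (owner's statement-level repair target: conclude
this, and Stub 4 is the bookkeeping below). DHRT arXiv:2104.08222, §1; Dafermos–Luk
arXiv:1710.01722, Conjecture 1. [cite: DafermosLuk2017, Conjecture 1] -/
theorem convergesToKerr_exteriorOf_of_strongChart (𝒟 : CauchyDevelopment D) {M a : ℝ} {k : ℕ}
    (τ₀ : ℝ) (Ψ : (Kerr.background M a).domain → 𝒟.carrier)
    (hΨs : ContMDiff 𝓘(ℝ, E4) (𝓡 4) ∞ Ψ)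
    (hΨe : IsOpenEmbedding ((Kerr.lateRegion M a τ₀).restrict Ψ))
    (hJ : Ψ '' Kerr.lateRegion M a τ₀ ⊆ 𝒟.metric.causalFuture 𝒟.timeOrientation (range 𝒟.embed))
    (ht : Tendsto (fun τ ↦ 𝒟.toSpacetime.deviationCk (Kerr.background M a) Ψ k τ) atTop (𝓝 0))
    (hcov : ∀ τ₁ : ℝ, τ₀ ≤ τ₁ →
      Summit.FinalStateConjecture.exteriorOf 𝒟 (Ψ '' Kerr.lateRegion M a τ₀) \
          Ψ '' Kerr.lateRegion M a τ₁ ⊆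
        𝒟.metric.causalPast 𝒟.timeOrientation (Ψ '' Kerr.timeSlab M a τ₁)) :
    𝒟.toSpacetime.IsLateEmbedding (Kerr.background M a)
        (Summit.FinalStateConjecture.exteriorOf 𝒟 (Ψ '' Kerr.lateRegion M a τ₀)) τ₀ Ψ ∧
      𝒟.toSpacetime.ConvergesToKerr
        (Summit.FinalStateConjecture.exteriorOf 𝒟 (Ψ '' Kerr.lateRegion M a τ₀)) M a k := by
  have hE : 𝒟.toSpacetime.IsLateEmbedding (Kerr.background M a)
      (Summit.FinalStateConjecture.exteriorOf 𝒟 (Ψ '' Kerr.lateRegion M a τ₀)) τ₀ Ψ :=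
    ⟨⟨hΨs, hΨe, image_lateRegion_subset_exteriorOf 𝒟 hΨe hJ⟩, hcov τ₀ le_rfl⟩
  exact ⟨hE, τ₀, Ψ, hE, ht⟩

/-- **BOOKKEEPING (the provable half of Stub 4): a STRONG Kerr chart gives the summit's
conclusion.** Let `𝒟 = (M, g, τ, ι, ν)` be a Cauchy development and `Ψ : Kerr.exterior M a → 𝒟`
(`0 < M`, `|a| < M`) a smooth map which is an open embedding of the late region `{t* > τ₀}`, BENT
above the data (`Ψ({t* > τ₀}) ⊆ J⁺(ι X)`), with full-slab `Cᵏ` deviation `Ψ^* g − g_{M,a} → 0`,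
and EXHAUSTIVE at every chart time `τ₁ ≥ τ₀`: every point of `O := J⁺(ι X) ∩ I⁻(Ψ({t* > τ₀}))`
not in `Ψ({t* > τ₁})` lies in `J⁻(Ψ({t* = τ₁}))`. Then `O` carries a one-hole (`N = 1`, mass `M`,
spin `a`, motion `(1, 0)`) `Cᵏ` final state decomposition `dec` with sub-extremal hole,
`O = exteriorOf 𝒟 dec.charted` and `HasExhaustiveCharts dec`. Construction (adapted from
`nonempty_finalStateDecomposition_of_convergesToKerr_holds`, `KerrConvergenceProofs`): hole chart
`Ψ` transported to `boostedKerrBackground 1 0 M a = Kerr.background M a`; excision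
`ρ(t) = max(r₊, 0) + 1 + √t`; flat domain `U = {x⁰ > τ₀, r > ρ(x⁰)}` with flat chart `Ψ|_U`
(`Ψ^* g − η = (Ψ^* g − g_{M,a}) + (g_{M,a} − η)`, `tendsto_deviationCk_backgroundOn`); certified
radii `R := ρ`, so that `certifiedLate τ₁ ⊇ Ψ({t* > τ₁})`, `certifiedSlab τ₁ ⊇ Ψ({t* = τ₁})`,
`dec.charted = Ψ({t* > τ₀})`, and every covering clause IS the exhaustion hypothesis.
Dafermos–Luk arXiv:1710.01722, Conjecture 1 (b)–(c); DHRT arXiv:2104.08222, §1.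
[cite: DafermosLuk2017, Conjecture 1] -/
theorem exists_finalStateDecomposition_of_strongChart (𝒟 : CauchyDevelopment D)
    {M a : ℝ} {k : ℕ} (hM : 0 < M) (ha : |a| < M) (τ₀ : ℝ)
    (Ψ : (Kerr.background M a).domain → 𝒟.carrier) (hΨs : ContMDiff 𝓘(ℝ, E4) (𝓡 4) ∞ Ψ)
    (hΨe : IsOpenEmbedding ((Kerr.lateRegion M a τ₀).restrict Ψ))
    (hJ : Ψ '' Kerr.lateRegion M a τ₀ ⊆ 𝒟.metric.causalFuture 𝒟.timeOrientation (range 𝒟.embed))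
    (ht : Tendsto (fun τ ↦ 𝒟.toSpacetime.deviationCk (Kerr.background M a) Ψ k τ) atTop (𝓝 0))
    (hcov : ∀ τ₁ : ℝ, τ₀ ≤ τ₁ →
      Summit.FinalStateConjecture.exteriorOf 𝒟 (Ψ '' Kerr.lateRegion M a τ₀) \
          Ψ '' Kerr.lateRegion M a τ₁ ⊆
        𝒟.metric.causalPast 𝒟.timeOrientation (Ψ '' Kerr.timeSlab M a τ₁)) :
    ∃ dec : FinalStateDecomposition 𝒟.toSpacetime
        (Summit.FinalStateConjecture.exteriorOf 𝒟 (Ψ '' Kerr.lateRegion M a τ₀)) k,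
      dec.N = 1 ∧ (∀ i, dec.mass i = M ∧ dec.spin i = a) ∧ dec.τ₀ = τ₀ ∧
      dec.charted = Ψ '' Kerr.lateRegion M a τ₀ ∧
      (∀ i, Kerr.IsSubextremal (dec.mass i) (dec.spin i)) ∧
        Summit.FinalStateConjecture.exteriorOf 𝒟 (Ψ '' Kerr.lateRegion M a τ₀) =
          Summit.FinalStateConjecture.exteriorOf 𝒟 dec.charted ∧
          Summit.FinalStateConjecture.HasExhaustiveCharts dec := by
  set O : Set 𝒟.carrier :=
    Summit.FinalStateConjecture.exteriorOf 𝒟 (Ψ '' Kerr.lateRegion M a τ₀) with hO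
  have himgO : Ψ '' Kerr.lateRegion M a τ₀ ⊆ O := image_lateRegion_subset_exteriorOf 𝒟 hΨe hJ
  have hΨ : 𝒟.toSpacetime.IsLateChart (Kerr.background M a) O τ₀ Ψ := ⟨hΨs, hΨe, himgO⟩
  -- the hole chart, transported to the boosted background of the trivial motion
  obtain ⟨Ψ', hΨ'c, htrunc, himage⟩ :=
    exists_chart_of_background_eq (𝓢 := 𝒟.toSpacetime) (boostedKerrBackground_one_zero M a) Ψ
  have hΨ' : 𝒟.toSpacetime.IsLateChart (boostedKerrBackground 1 0 M a) O τ₀ Ψ' := hΨ'c O τ₀ hΨ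
  -- the excision radius
  set C₀ : ℝ := max (Kerr.rPlus M a) 0 + 1 with hC₀
  set ρ : ℝ → ℝ := fun t ↦ C₀ + √t with hρ
  have hρc : Continuous ρ := continuous_const.add Real.continuous_sqrt
  have hρC : ∀ t, C₀ ≤ ρ t := fun t ↦ le_add_of_nonneg_right (Real.sqrt_nonneg t)
  have hρtop : Tendsto ρ atTop atTop := tendsto_atTop_add_const_left _ C₀ Real.tendsto_sqrt_atTop
  have hρdiv : Tendsto (fun t ↦ ρ t / t) atTop (𝓝 0) := by
    have h1 : Tendsto (fun t : ℝ ↦ C₀ / t) atTop (𝓝 0) := tendsto_const_nhds.div_atTop tendsto_id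
    have h2 : Tendsto (fun t : ℝ ↦ √t / t) atTop (𝓝 0) := by
      simp_rw [Real.sqrt_div_self]
      exact tendsto_inv_atTop_zero.comp Real.tendsto_sqrt_atTop
    simpa [hρ, add_div] using h1.add h2
  -- the flat domain
  have hc0 : Continuous fun y : E4 ↦ y 0 := PiLp.continuous_apply 2 _ 0
  let U : TopologicalSpace.Opens E4 := ⟨{x | τ₀ < x 0 ∧ ρ (x 0) < Kerr.radius a x},
    (isOpen_lt continuous_const hc0).inter (isOpen_lt (hρc.comp hc0) (Kerr.continuous_radius a))⟩
  have hUK : (Minkowski.backgroundOn U).domain ≤ (Kerr.background M a).domain := by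
    intro x hx
    change max (Kerr.rPlus M a) 0 < Kerr.radius a x
    have h2 : ρ (x 0) < Kerr.radius a x := hx.2
    have h3 := hρC (x 0)
    linarith
  have hUρ : ∀ z ∈ U, ρ (z 0) < Kerr.radius a z := fun z hz ↦ hz.2
  -- membership in the flat image, read through `Ψ`
  have hmem_flat : ∀ (y : (Kerr.background M a).domain) (A : Set (Minkowski.backgroundOn U).domain)
      (hyU : (y : E4) ∈ U), (⟨y.1, hyU⟩ : (Minkowski.backgroundOn U).domain) ∈ A →
      Ψ y ∈ (Ψ ∘ TopologicalSpace.Opens.inclusion hUK) '' A := by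
    intro y A hyU hA
    exact ⟨⟨y.1, hyU⟩, hA, rfl⟩
  -- the flat image lies in the late image of `Ψ`
  have hflat_late : ∀ τ₁ : ℝ, τ₀ ≤ τ₁ →
      (Ψ ∘ TopologicalSpace.Opens.inclusion hUK) '' (Minkowski.backgroundOn U).lateRegion τ₁ ⊆
        Ψ '' Kerr.lateRegion M a τ₁ := by
    rintro τ₁ - _ ⟨x, hx, rfl⟩
    exact ⟨TopologicalSpace.Opens.inclusion hUK x, hx, rfl⟩
  -- images of the transported hole chart `Ψ'`, read through `Ψ`
  have hlate' : ∀ τ₁ : ℝ, Ψ' '' (boostedKerrBackground 1 0 M a).lateRegion τ₁ =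
      Ψ '' Kerr.lateRegion M a τ₁ := fun τ₁ ↦ himage (fun t _ ↦ τ₁ < t)
  have hslab' : ∀ τ₁ : ℝ, Ψ' '' (boostedKerrBackground 1 0 M a).timeSlab τ₁ =
      Ψ '' Kerr.timeSlab M a τ₁ := fun τ₁ ↦ himage (fun t _ ↦ t = τ₁)
  have htrunc' : ∀ R τ₁ : ℝ, Ψ' '' (boostedKerrBackground 1 0 M a).truncTimeSlab R τ₁ =
      Ψ '' (Kerr.background M a).truncTimeSlab R τ₁ := fun R τ₁ ↦ himage (fun t r ↦ t = τ₁ ∧ r ≤ R)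
  have hcert' : ∀ (R : ℝ → ℝ) (τ₁ : ℝ),
      Ψ' '' {x | τ₁ < (boostedKerrBackground 1 0 M a).time x.1 ∧
        (boostedKerrBackground 1 0 M a).radius x.1 ≤ R ((boostedKerrBackground 1 0 M a).time x.1)} =
      Ψ '' {x | τ₁ < (Kerr.background M a).time x.1 ∧
        (Kerr.background M a).radius x.1 ≤ R ((Kerr.background M a).time x.1)} :=
    fun R τ₁ ↦ himage (fun t r ↦ τ₁ < t ∧ r ≤ R t)
  -- truncated convergence of the hole chart, for any radius function
  have htruncT : ∀ R : ℝ → ℝ, Tendsto (fun τ ↦ 𝒟.toSpacetime.truncDeviationCk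
      (boostedKerrBackground 1 0 M a) Ψ' k (R τ) τ) atTop (𝓝 0) := by
    intro R
    refine tendsto_of_tendsto_of_tendsto_of_le_of_le tendsto_const_nhds ht (fun _ ↦ zero_le)
      fun τ ↦ ?_
    rw [htrunc]
    exact 𝒟.toSpacetime.truncDeviationCk_le_deviationCk _ Ψ k (R τ) τ
  -- the charted region is the late image of `Ψ`
  have hcharted : (Ψ ∘ TopologicalSpace.Opens.inclusion hUK) ''
        (Minkowski.backgroundOn U).lateRegion τ₀ ∪
      ⋃ _i : Fin 1, Ψ' '' (boostedKerrBackground 1 0 M a).lateRegion τ₀ =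
      Ψ '' Kerr.lateRegion M a τ₀ := by
    apply Subset.antisymm
    · exact union_subset (hflat_late τ₀ le_rfl) (iUnion_subset fun _ ↦ (hlate' τ₀).le)
    · exact fun p hp ↦ Or.inr (mem_iUnion.mpr ⟨0, (hlate' τ₀).ge hp⟩)
  -- the global covering clause is exhaustion at `τ₁ = τ₀`
  have hcov0 : O \ ((⋃ _i : Fin 1, Ψ' '' (boostedKerrBackground 1 0 M a).lateRegion τ₀) ∪
      (Ψ ∘ TopologicalSpace.Opens.inclusion hUK) '' (Minkowski.backgroundOn U).lateRegion τ₀) ⊆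
      𝒟.metric.causalPast 𝒟.timeOrientation
        ((⋃ _i : Fin 1, Ψ' '' (boostedKerrBackground 1 0 M a).timeSlab τ₀) ∪
          (Ψ ∘ TopologicalSpace.Opens.inclusion hUK) '' (Minkowski.backgroundOn U).timeSlab τ₀) := by
    intro p hp
    have hp' : p ∈ O \ Ψ '' Kerr.lateRegion M a τ₀ := by
      refine ⟨hp.1, fun hpΨ ↦ hp.2 (Or.inl ?_)⟩
      rw [← hlate'] at hpΨ
      exact mem_iUnion.mpr ⟨0, hpΨ⟩
    refine LorentzianMetric.causalFuture_mono ?_ (hcov τ₀ le_rfl hp')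
    rw [← hslab']
    exact (subset_iUnion (fun _i : Fin 1 ↦ Ψ' '' (boostedKerrBackground 1 0 M a).timeSlab τ₀)
      0).trans subset_union_left
  refine ⟨{
    N := 1
    mass := fun _ ↦ M
    spin := fun _ ↦ a
    mass_pos := fun _ ↦ hM
    abs_spin_le_mass := fun _ ↦ ha.le
    motion := fun _ ↦ (1, 0)
    τ₀ := τ₀
    chart := fun _ ↦ Ψ'
    isLateChart := fun _ ↦ hΨ'
    tendsto_truncDeviationCk := fun _ R ↦ htruncT fun _ ↦ R
    exists_pairwise_disjoint := fun _ ↦ ⟨0, Subsingleton.pairwise⟩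
    excision := fun _ ↦ ρ
    tendsto_excision_div := fun _ ↦ hρdiv
    flatDomain := U
    setOf_lt_excision_subset_flatDomain := fun x hx ↦ ⟨hx.1, by simpa using hx.2 0⟩
    flatChart := Ψ ∘ TopologicalSpace.Opens.inclusion hUK
    isLateChart_flat := 𝒟.toSpacetime.isLateChart_backgroundOn_comp_inclusion hΨ hUK
    tendsto_deviationCk_flat :=
      𝒟.toSpacetime.tendsto_deviationCk_backgroundOn hΨs ht hρtop hUρ hUK
    diff_subset_causalPast := hcov0 }, rfl, fun _ ↦ ⟨rfl, rfl⟩, rfl, hcharted, fun _ ↦ ha, ?_, ?_⟩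
  · -- `O = exteriorOf 𝒟 dec.charted`
    show O = Summit.FinalStateConjecture.exteriorOf 𝒟
      ((Ψ ∘ TopologicalSpace.Opens.inclusion hUK) '' (Minkowski.backgroundOn U).lateRegion τ₀ ∪
        ⋃ _i : Fin 1, Ψ' '' (boostedKerrBackground 1 0 M a).lateRegion τ₀)
    rw [hcharted]
  · -- `HasExhaustiveCharts dec` with certified radii `R := ρ` (honest radii, Statement re-type T2 2026-08-16:
    -- `ρ → ∞` and `ρ(τ) ≥ max (r₊(M, a)) 0 + 1` hold by construction of the excision radius)
    refine ⟨fun _ ↦ ρ, fun _ ↦ ⟨hρtop, fun τ ↦ hρC τ⟩, fun _ ↦ htruncT ρ, fun τ₁ hτ₁ ↦ ?_⟩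
    have hτ₁' : τ₀ < τ₁ := hτ₁
    intro p hp
    have hp' : p ∈ O \ Ψ '' Kerr.lateRegion M a τ₁ := by
      refine ⟨hp.1, ?_⟩
      rintro ⟨y, hy, hyp⟩
      apply hp.2
      have hy' : τ₁ < y.1 0 := hy
      rw [← hyp]
      by_cases hr : ρ (y.1 0) < Kerr.radius a y.1
      · have hyU : (y : E4) ∈ U := ⟨hτ₁'.trans hy', hr⟩
        exact Or.inl (hmem_flat y _ hyU hy')
      · push Not at hr
        refine Or.inr (mem_iUnion.mpr ⟨0, ?_⟩)
        show Ψ y ∈ Ψ' '' {x | τ₁ < (boostedKerrBackground 1 0 M a).time x.1 ∧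
          (boostedKerrBackground 1 0 M a).radius x.1 ≤ ρ ((boostedKerrBackground 1 0 M a).time x.1)}
        rw [hcert' ρ τ₁]
        exact ⟨y, ⟨hy', hr⟩, rfl⟩
    refine LorentzianMetric.causalFuture_mono ?_ (hcov τ₁ hτ₁'.le hp')
    rintro _ ⟨y, hy, rfl⟩
    have hy' : y.1 0 = τ₁ := hy
    by_cases hr : ρ (y.1 0) < Kerr.radius a y.1
    · have hyU : (y : E4) ∈ U := ⟨by rw [hy']; exact hτ₁', hr⟩
      exact Or.inl (hmem_flat y _ hyU hy')
    · push Not at hr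
      refine Or.inr (mem_iUnion.mpr ⟨0, ?_⟩)
      show Ψ y ∈ Ψ' '' (boostedKerrBackground 1 0 M a).truncTimeSlab (ρ τ₁) τ₁
      rw [htrunc' (ρ τ₁) τ₁]
      exact ⟨y, ⟨hy', by rw [← hy']; exact hr⟩, rfl⟩

end Strong

/-! ## §2 The corollary in the registered stub's own vocabulary -/

section StubVocabulary

variable {X : Type} [TopologicalSpace X] [ChartedSpace E3 X] [IsManifold (𝓡 3) ∞ X]
  [ConnectedSpace X] {D : InitialDataSet (𝓡 3) X}

/-- **Registered sub-stub `stub_softShieldedDecomposition_bookkeeping` — Stub 4 from a strong chart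
(verbatim conclusion of `stub_softShieldedDecomposition`).** In a vacuum Cauchy development `𝓜`, a
sub-extremal `(M', a')` and ONE smooth ingoing Kerr–Schild chart `Ψ` which is an open embedding of
`{t* > τ₀}`, bent above `ι X`, with full-slab `C²` deviation `→ 0` and exhaustive at every chart
time `τ₁ ≥ τ₀` give `∃ O dec, (∀ i, IsSubextremal) ∧ O = exteriorOf 𝓜 dec.charted ∧
HasExhaustiveCharts dec` — the three conjuncts of the registered stub, with
`O = J⁺(ι X) ∩ I⁻(Ψ({t* > τ₀}))`. This is the bookkeeping two-thirds of Stub 4; what it does NOT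
supply (the strong chart from the `∃ 𝒟oc` capture chart: bending, orientation, horizon
normalisation by the red-shift strip estimate, exhaustion) is the typed gap B2.
Dafermos–Luk arXiv:1710.01722, Conjecture 1. [cite: DafermosLuk2017, Conjecture 1] -/
theorem stub_softShieldedDecomposition_bookkeeping : ∀ (X : Type) [TopologicalSpace X] [ChartedSpace E3 X] [IsManifold (𝓡 3) ∞ X] [ConnectedSpace X] (D : InitialDataSet (𝓡 3) X) (𝓜 : VacuumCauchyDevelopment D) (M' a' : ℝ), Kerr.IsSubextremal M' a' → ∀ (τ₀ : ℝ) (Ψ : (Kerr.background M' a').domain → 𝓜.carrier), ContMDiff 𝓘(ℝ, E4) (𝓡 4) ∞ Ψ → Topology.IsOpenEmbedding ((Kerr.lateRegion M' a' τ₀).restrict Ψ) → Ψ '' Kerr.lateRegion M' a' τ₀ ⊆ 𝓜.metric.causalFuture 𝓜.timeOrientation (Set.range 𝓜.embed) → Filter.Tendsto (fun τ ↦ 𝓜.toSpacetime.deviationCk (Kerr.background M' a') Ψ 2 τ) Filter.atTop (nhds 0) → (∀ τ₁ : ℝ, τ₀ ≤ τ₁ → Summit.FinalStateConjecture.exteriorOf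 𝓜.toCauchyDevelopment (Ψ '' Kerr.lateRegion M' a' τ₀) \ Ψ '' Kerr.lateRegion M' a' τ₁ ⊆ 𝓜.metric.causalPast 𝓜.timeOrientation (Ψ '' Kerr.timeSlab M' a' τ₁)) → ∃ (O : Set 𝓜.carrier) (dec : FinalStateDecomposition 𝓜.toSpacetime O 2), (∀ i, Kerr.IsSubextremal (dec.mass i) (dec.spin i)) ∧ O = Summit.FinalStateConjecture.exteriorOf 𝓜.toCauchyDevelopment dec.charted ∧ Summit.FinalStateConjecture.HasExhaustiveCharts dec := by
  intro X _ _ _ _ D 𝓜 M' a' hsub τ₀ Ψ hΨs hΨe hJ ht hcov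
  obtain ⟨dec, -, -, -, -, hsub', hO, hex⟩ := exists_finalStateDecomposition_of_strongChart
    𝓜.toCauchyDevelopment hsub.pos hsub τ₀ Ψ hΨs hΨe hJ ht hcov
  exact ⟨_, dec, hsub', hO, hex⟩

end StubVocabulary



end Summit.FinalStateConjecture.FinalStateConjecture.Theorems.CaptureSufficesC2.Sketch

end
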